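import Mathlib
import Summits.Ventures.HodgeRepro2.Tier7.Line3.LatticeBoxCount

/-!
# Tier7/Line3/NumberFieldBoxCount — `M⁻¹ O_K` in a box of archimedean sizes (seat t7-x1)

LINE 3 (t7-plan-3), version-(ii) isolation — the DICTIONARY item (iv) of STATUS l. 14948: the values
`x = κ(γ) − κ(γ₀)` of the orbits carrying weight lie in `M⁻¹ O_F` (`F = E′⁺` totally real; denominators bounded by
the finite-place support), and the count hypothesis of the dominant-term rows is a count of such `x` with the
archimedean absolute values `|x|_w ≤ R_w`. THIS FILE proves, for ANY number field `K` all of whose infinite places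
are real and any `M ≠ 0`:
`#{x ∈ K : M x integral, ∀ w | ∞, |x|_w ≤ R_w} ≤ K₀ · ∏_w (2 R_w + 3)`, `K₀ = #{x ∈ M⁻¹O_K : ∀ w, |x|_w ≤ 1} < ∞`
— by embedding `M⁻¹ O_K` through the real embeddings into `InfinitePlace K → ℝ` (a ring hom, injective), applying
the box count `LatticeBoxCount.ncard_box_le_real`, and proving the unit box FINITE from Mathlib's
`NumberField.Embeddings.finite_of_norm_le` (finitely many algebraic integers with all conjugates bounded): a unit-box
element `x` has `z = M x` integral with `‖φ z‖ ≤ max_w |M|_w` for every complex embedding `φ`.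

Mathlib + this prefix only; nothing here is about a group, a double coset, an orbital integral or a period. Blind
lane; no sorry; axioms ⊆ {propext, Classical.choice, Quot.sound}.
-/

namespace Summit.Ventures.HodgeRepro2.Tier7.Line3.NumberFieldBoxCount

open NumberField Summit.Ventures.HodgeRepro2.Tier7.Line3.LatticeBoxCount

variable {K : Type*} [Field K] [NumberField K]

/-- `M⁻¹ O_K`: the elements `x` of `K` with `M x` integral over `ℤ`, as an additive subgroup. -/
def scaledIntegers (M : K) : AddSubgroup K where
  carrier := {x | IsIntegral ℤ (M * x)}
  zero_mem' := by simp [isIntegral_zero]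
  add_mem' := fun {a b} ha hb => by
    simp only [Set.mem_setOf_eq] at ha hb ⊢
    simpa [mul_add] using ha.add hb
  neg_mem' := fun {a} ha => by
    simp only [Set.mem_setOf_eq] at ha ⊢
    simpa [mul_neg] using ha.neg

omit [NumberField K] in
/-- membership in `M⁻¹ O_K`. -/
theorem mem_scaledIntegers {M x : K} : x ∈ scaledIntegers M ↔ IsIntegral ℤ (M * x) := Iff.rfl

/-- the real embeddings of a totally real field, as one ring hom into `InfinitePlace K → ℝ`. -/
noncomputable def realEmb (hK : ∀ w : InfinitePlace K, w.IsReal) : K →+* (InfinitePlace K → ℝ) :=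
  RingHom.pi fun w => InfinitePlace.embedding_of_isReal (hK w)

omit [NumberField K] in
/-- the coordinates of the real embedding are the absolute values at the infinite places. -/
theorem abs_realEmb_apply (hK : ∀ w : InfinitePlace K, w.IsReal) (x : K) (w : InfinitePlace K) :
    |realEmb hK x w| = w x := by
  rw [← Real.norm_eq_abs]
  exact InfinitePlace.norm_embedding_of_isReal (hK w) x

/-- the real embedding is injective (a ring hom out of a field). -/
theorem realEmb_injective (hK : ∀ w : InfinitePlace K, w.IsReal) : Function.Injective (realEmb hK) :=
  (realEmb hK).injective

/-- the image of `M⁻¹ O_K` in `InfinitePlace K → ℝ`. -/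
noncomputable def lattice (hK : ∀ w : InfinitePlace K, w.IsReal) (M : K) :
    AddSubgroup (InfinitePlace K → ℝ) :=
  (scaledIntegers M).map (realEmb hK).toAddMonoidHom

omit [NumberField K] in
/-- membership in the image lattice. -/
theorem mem_lattice {hK : ∀ w : InfinitePlace K, w.IsReal} {M : K} {y : InfinitePlace K → ℝ} :
    y ∈ lattice hK M ↔ ∃ x, IsIntegral ℤ (M * x) ∧ realEmb hK x = y := by
  simp [lattice, AddSubgroup.mem_map, mem_scaledIntegers]

/-- a bound for `|M|_w` over all infinite places: the sum. -/
noncomputable def sizeBound (M : K) : ℝ := ∑ w : InfinitePlace K, w M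

omit [NumberField K] in
/-- the absolute value attached to a complex embedding `φ` is `‖φ x‖ = (mk φ) x`. -/
theorem norm_apply_eq (φ : K →+* ℂ) (x : K) : ‖φ x‖ = (InfinitePlace.mk φ) x := rfl

/-- **the unit box of `M⁻¹ O_K` is finite** (`NumberField.Embeddings.finite_of_norm_le`). -/
theorem unitBox_finite (hK : ∀ w : InfinitePlace K, w.IsReal) (M : K) (hM : M ≠ 0) :
    (unitBox (lattice hK M)).Finite := by
  have hfin := Embeddings.finite_of_norm_le K ℂ (sizeBound M)
  refine (hfin.image fun z => realEmb hK (M⁻¹ * z)).subset ?_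
  rintro y ⟨hy, hbox⟩
  obtain ⟨x, hx, rfl⟩ := mem_lattice.1 hy
  refine ⟨M * x, ⟨hx, fun φ => ?_⟩, ?_⟩
  · rw [norm_apply_eq, map_mul]
    have h1 : (InfinitePlace.mk φ) x ≤ 1 := by
      rw [← abs_realEmb_apply hK x]; exact hbox _
    have h2 : (InfinitePlace.mk φ) M ≤ sizeBound M :=
      Finset.single_le_sum (fun w _ => apply_nonneg w M) (Finset.mem_univ _)
    calc (InfinitePlace.mk φ) M * (InfinitePlace.mk φ) x ≤ sizeBound M * 1 :=
          mul_le_mul h2 h1 (apply_nonneg _ _) (Finset.sum_nonneg fun w _ => apply_nonneg w M)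
      _ = sizeBound M := mul_one _
  · simp only
    rw [← mul_assoc, inv_mul_cancel₀ hM, one_mul]

omit [NumberField K] in
/-- the elements of `M⁻¹ O_K` in the archimedean box `|x|_w ≤ R_w` inject into the box of the image lattice. -/
theorem image_subset_box (hK : ∀ w : InfinitePlace K, w.IsReal) (M : K) (R : InfinitePlace K → ℝ) :
    ∀ x ∈ {x : K | IsIntegral ℤ (M * x) ∧ ∀ w : InfinitePlace K, w x ≤ R w},
      realEmb hK x ∈ box (lattice hK M) R := by
  rintro x ⟨hx, hR⟩
  refine ⟨mem_lattice.2 ⟨x, hx, rfl⟩, fun w => ?_⟩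
  rw [abs_realEmb_apply]; exact hR w

open scoped Classical in
/-- **the number-field box count**: for a totally real `K`, `M ≠ 0` and sides `R_w ≥ 0`,
`#{x ∈ K : M x integral ∧ ∀ w, |x|_w ≤ R_w} ≤ K₀ · ∏_w (2 R_w + 3)` with `K₀ = #(unit box of M⁻¹O_K) < ∞`. -/
theorem ncard_le (hK : ∀ w : InfinitePlace K, w.IsReal) (M : K) (hM : M ≠ 0)
    (R : InfinitePlace K → ℝ) (hR : ∀ w, 0 ≤ R w) :
    (({x : K | IsIntegral ℤ (M * x) ∧ ∀ w : InfinitePlace K, w x ≤ R w}).ncard : ℝ) ≤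
      ((unitBox (lattice hK M)).ncard : ℝ) * ∏ w : InfinitePlace K, (2 * R w + 3) := by
  have hfinbox : (box (lattice hK M) R).Finite := box_finite _ (unitBox_finite hK M hM) R
  have h1 : ({x : K | IsIntegral ℤ (M * x) ∧ ∀ w : InfinitePlace K, w x ≤ R w}).ncard ≤
      (box (lattice hK M) R).ncard :=
    Set.ncard_le_ncard_of_injOn (realEmb hK) (image_subset_box hK M R)
      (Set.injOn_of_injective (realEmb_injective hK)) hfinbox
  calc (({x : K | IsIntegral ℤ (M * x) ∧ ∀ w : InfinitePlace K, w x ≤ R w}).ncard : ℝ)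
      ≤ ((box (lattice hK M) R).ncard : ℝ) := by exact_mod_cast h1
    _ ≤ ((unitBox (lattice hK M)).ncard : ℝ) * ∏ w : InfinitePlace K, (2 * R w + 3) :=
        ncard_box_le_real _ (unitBox_finite hK M hM) R hR

open scoped Classical in
/-- **the finite-set form** (the shape of the dominant-term rows' `count_bound`): a finset containing every
`x ∈ M⁻¹O_K` with `|x|_w ≤ R_w`, of cardinality `≤ K₀ · ∏_w (2 R_w + 3)`. -/
theorem exists_finset (hK : ∀ w : InfinitePlace K, w.IsReal) (M : K) (hM : M ≠ 0)
    (R : InfinitePlace K → ℝ) (hR : ∀ w, 0 ≤ R w) :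
    ∃ s : Finset K, (∀ x, IsIntegral ℤ (M * x) → (∀ w : InfinitePlace K, w x ≤ R w) → x ∈ s) ∧
      (s.card : ℝ) ≤ ((unitBox (lattice hK M)).ncard : ℝ) * ∏ w : InfinitePlace K, (2 * R w + 3) := by
  have hfinbox : (box (lattice hK M) R).Finite := box_finite _ (unitBox_finite hK M hM) R
  have hfin : ({x : K | IsIntegral ℤ (M * x) ∧ ∀ w : InfinitePlace K, w x ≤ R w}).Finite :=
    Set.Finite.of_finite_image (hfinbox.subset (Set.image_subset_iff.2 (image_subset_box hK M R)))
      (Set.injOn_of_injective (realEmb_injective hK))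
  refine ⟨hfin.toFinset, fun x hx hR' => ?_, ?_⟩
  · rw [Set.Finite.mem_toFinset]; exact ⟨hx, hR'⟩
  · rw [← Set.ncard_eq_toFinset_card _ hfin]
    exact ncard_le hK M hM R hR

end Summit.Ventures.HodgeRepro2.Tier7.Line3.NumberFieldBoxCount
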